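import Summits.NavierStokesRegularity.NavierStokesRegularity.Theorems.OddMorawetzOddMorawetzLocalEvaluatorIBP
import Summits.NavierStokesRegularity.NavierStokesRegularity.Theorems.OddMorawetzOddMorawetzLocalHermExpSound
import Summits.NavierStokesRegularity.NavierStokesRegularity.Theorems.OddMorawetzOddMorawetzLocalPairingValue
import Summits.NavierStokesRegularity.NavierStokesRegularity.Theorems.OddMorawetzOddMorawetzLocalPairingProps
import HarnessLib

/-!
# Crux `OddMorawetzLocal` (stmt-NavierStokesRegularity-1376), refutation — evaluator soundness 4/4: the value

Support file for the refutation skeleton of `OddMorawetzLocal` (line `registered`, lead c1), registered stub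
`morawetzPairing_pgv_eq`.  It assembles the three landed soundness parts of the kernel evaluator
(`OddMorawetzLocalEvaluatorDefs`) with the landed general evaluation `pairing_value`:

* `epoly_semantics` (`…EPolySemantics`): the list polynomials `EPoly` map homomorphically to `P3`
  (`toP3_ediv`, `toP3_eWP`, `toP3_norm`, `toP3_flatMap`, `toP3_mul`, …);
* `hermExp_sound` (`…HermExpSound`): the kernel's Hermite data and parity conversions satisfy the four data
  identities of `pairing_value`, and the moment sums collapse to `locMoment · π√π`, `rieszPair · √π`;
* `evaluator_ibp` (`…EvaluatorIBP`): `∫ lin p (Jv)(J B(v,v)) = ∫ ⟪B(v,v), pgv 2 (toP3v (eEP p P))⟫` for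
  `v = pgv 1 (toP3v P)` divergence free and `p` cubic of jet orders `≤ 3`.

Contents:
* `EvaluatorSound.evalRes_spec` — reading the success flag of `evalRes fuel q P = (true, ρ)`: the field is
  divergence free (`norm (ediv 1 P) = []`), both Hermite eliminations end with empty remainder, the three parity
  flags hold, and `ρ = ½ (locMoment L − rieszPair A B / 32)`;
* `EvaluatorSound.sum_dg_one_eq_zero` — the divergence flag gives `∑ᵢ dg 1 i (toP3v P i) = 0`;
* `EvaluatorSound.integral_lin_chunk_eq` — ONE chunk: if `evalRes fuel q P = (true, ρ)` and the monomials of `q`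
  are basis monomials, then `∫ lin q (Jv)(J B(v,v)) = -ρ · π√π` (`evaluator_ibp`, then `pairing_value` with the
  kernel data, then `mloc_sum_eq` / `mfour_sum_eq` and `((2π)²)⁻¹ (π/2)³ = π/32`);
* `EvaluatorSound.lin_take_eq_sum` — `lin` is additive over the chunks `(p.drop (sz·j)).take sz`, `j < n`, of
  `p.take (sz·n)` (`List.take_add`, `NullLemmas.lin_append`);
* `morawetzPairing_pgv_eq` — the registered statement: `v` is a divergence-free Schwartz field and
  `morawetzPairing k v (vecOf k p) = (Σ_{j<n} r j) · π√π` when every chunk evaluates to `(true, r j)`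
  (`lin_polyOfV_vecOf`, `integral_finsetSum`).

Mathlib list / integral API on top of the landed files above; no definitions, no named facts.
-/

noncomputable section

open MeasureTheory MvPolynomial
open scoped RealInnerProductSpace

-- the problem namespace `Summit.NavierStokesRegularity.NavierStokesRegularity` repeats the summit name by design (D-0017)
set_option linter.dupNamespace false
set_option autoImplicit false

namespace Summit.NavierStokesRegularity.NavierStokesRegularity.Theorems.OddMorawetz

namespace EvaluatorSound

open Literature.Analysis.FluidPDE

/-! ### Reading the flag -/

/-- **The success flag of the evaluator.**  `evalRes fuel q P = (true, ρ)` says: the normal form of `div P` (rate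
`1`) is empty, the Hermite eliminations of `div W` and `div G` end with empty remainder, their coefficient lists
and the local product are even, and `ρ = ½ (locMoment (eLoc P (eEP q P)) − rieszPair (eHermW) (eHermG) / 32)`. -/
theorem evalRes_spec (fuel : ℕ) (q : JPoly ℤ) (P : EField) (ρ : ℚ) (h : evalRes fuel q P = (true, ρ)) :
    EPoly.norm (ediv 1 P) = [] ∧ (EPoly.hermExp fuel (ediv 2 (eWP P))).2 = [] ∧
    (EPoly.hermExp fuel (ediv 2 (eEP q P))).2 = [] ∧ EPoly.allEven (eHermW fuel P) = true ∧
    EPoly.allEven (eHermG fuel q P) = true ∧ EPoly.allEven (eLoc P (eEP q P)) = true ∧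
    2⁻¹ * (EPoly.locMoment (eLoc P (eEP q P)) -
      EPoly.rieszPair (eHermW fuel P) (eHermG fuel q P) / 32) = ρ := by
  unfold evalRes at h
  unfold eHermW eHermG
  simp only [Prod.mk.injEq, Bool.and_eq_true, List.isEmpty_iff, and_assoc] at h
  exact h

/-- **Divergence-freeness from the flag**: an empty normal form of `ediv 1 P` means `∑ᵢ dg 1 i (toP3v P i) = 0`. -/
theorem sum_dg_one_eq_zero (P : EField) (h : EPoly.norm (ediv 1 P) = []) : ∑ i, dg 1 i (toP3v P i) = 0 := by
  have h1 : EPoly.toP3 (ediv 1 P) = 0 := by rw [← toP3_norm, h, toP3_nil]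
  rw [toP3_ediv] at h1
  simpa only [toP3v_apply] using h1

/-- Basis monomials are cubic with jet orders `≤ 3` (the hypothesis format of `evaluator_ibp`). -/
theorem cubic_of_mem_idx {k : ℕ} (q : JPoly ℤ) (hq : ∀ t ∈ q, t.2 ∈ idx k) :
    ∀ t ∈ q, t.2.length = 3 ∧ ∀ w ∈ t.2, w.2.length ≤ 3 := fun t ht =>
  ⟨(canonical_of_mem_idx (hq t ht)).2.1, fun w hw => ((canonical_of_mem_idx (hq t ht)).2.2.1 w hw).2⟩

/-! ### One chunk -/

/-- **One chunk of the evaluation.**  For an explicit field `P` and an integer jet polynomial `q` on the basis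
`idx k` with `evalRes fuel q P = (true, ρ)`: the pairing integrand `lin q (Jv)(J B(v,v))`, `v = pgv 1 (toP3v P)`,
is integrable and `∫ lin q (Jv)(J B(v,v)) = -ρ · π√π`.  Integration by parts (`evaluator_ibp`) turns the integral
into `∫ ⟪B(v,v), pgv 2 (toP3v (eEP q P))⟫`; `pairing_value` evaluates it from the kernel's Hermite data
(`toP3_hermExp`, `pev_hermSum_eq_toLW`), the even local product (`pev_toP3_eq_polyE`) and the symbol product
(`hermVal_toLW_mul`); the moment sums are `locMoment · π√π` and `rieszPair · √π` (`mloc_sum_eq`, `mfour_sum_eq`),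
and `-½ [lM π√π − (2π)⁻² (π/2)³ rP √π] = -½ (lM − rP/32) π√π = -ρ π√π`. -/
theorem integral_lin_chunk_eq (k fuel : ℕ) (q : JPoly ℤ) (P : EField) (ρ : ℚ)
    (hres : evalRes fuel q P = (true, ρ)) (hq : ∀ t ∈ q, t.2 ∈ idx k) :
    Integrable (fun x => JPoly.lin (q.map fun t => ((t.1 : ℝ), t.2)) (jetVal (pgv 1 (toP3v P)) x)
        (jetVal (eulerBilinear (pgv 1 (toP3v P)) (pgv 1 (toP3v P))) x)) ∧
    ∫ x, JPoly.lin (q.map fun t => ((t.1 : ℝ), t.2)) (jetVal (pgv 1 (toP3v P)) x)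
        (jetVal (eulerBilinear (pgv 1 (toP3v P)) (pgv 1 (toP3v P))) x) =
      -(ρ : ℝ) * (Real.pi * Real.sqrt Real.pi) := by
  obtain ⟨hdiv0, hremW, hremG, hA, hB, hL, hval⟩ := evalRes_spec fuel q P ρ hres
  have hdiv := sum_dg_one_eq_zero P hdiv0
  obtain ⟨hint, hibp⟩ := evaluator_ibp P hdiv q (cubic_of_mem_idx q hq)
  refine ⟨hint, ?_⟩
  rw [hibp]
  -- the four data identities of `pairing_value`
  have hW : ∀ x, pev (rhoWP (toP3v P)) x =
      ((toLW (eHermW fuel P)).map fun dl => dl.1 * pev (dgList 2 (pairs dl.2) 1) x).sum := by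
    intro x
    have e : rhoWP (toP3v P) = EPoly.toP3 (ediv 2 (eWP P)) := by
      rw [toP3_ediv, rhoWP]
      simp only [toP3_eWP]
    rw [e, toP3_hermExp fuel _ hremW]
    exact pev_hermSum_eq_toLW _ hA x
  have hG : ∀ x, pev (∑ i, dg 2 i (toP3v (eEP q P) i)) x =
      ((toLW (eHermG fuel q P)).map fun dl => dl.1 * pev (dgList 2 (pairs dl.2) 1) x).sum := by
    intro x
    have e : ∑ i, dg 2 i (toP3v (eEP q P) i) = EPoly.toP3 (ediv 2 (eEP q P)) := by
      rw [toP3_ediv]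
      simp only [toP3v_apply]
    rw [e, toP3_hermExp fuel _ hremG]
    exact pev_hermSum_eq_toLW _ hB x
  have hloc : ∀ x, pev (∑ i, WP (toP3v P) i * toP3v (eEP q P) i) x = polyE (toMloc (eLoc P (eEP q P))) x := by
    intro x
    have e : ∑ i, WP (toP3v P) i * toP3v (eEP q P) i = EPoly.toP3 (eLoc P (eEP q P)) := by
      rw [eLoc, toP3_norm, toP3_flatMap, Fin.sum_univ_def]
      simp only [toP3_mul, toP3_eWP, toP3v_apply]
    rw [e]
    exact pev_toP3_eq_polyE _ hL x
  have hfour : ∀ ξ, hermVal (toLW (eHermW fuel P)) ξ * hermVal (toLW (eHermG fuel q P)) ξ =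
      polyE (toMfour (eHermW fuel P) (eHermG fuel q P)) ξ := fun ξ => hermVal_toLW_mul _ _ hA hB ξ
  rw [pairing_value (toP3v P) (toP3v (eEP q P)) _ _ _ _ hW hG hloc hfour, mloc_sum_eq, mfour_sum_eq _ _ hA hB,
    ← hval]
  have hπ : Real.pi ≠ 0 := Real.pi_ne_zero
  push_cast
  field_simp
  ring

/-! ### Chunking -/

/-- **`lin` is additive over the chunks**: the linearisation of (the cast of) `p.take (sz·n)` is the sum over
`j < n` of the linearisations of the chunks `(p.drop (sz·j)).take sz`. -/
theorem lin_take_eq_sum (l : JPoly ℤ) (sz : ℕ) (ζ η : JVar → ℝ) : ∀ n : ℕ,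
    JPoly.lin ((l.take (sz * n)).map fun t => ((t.1 : ℝ), t.2)) ζ η =
      ∑ j ∈ Finset.range n, JPoly.lin (((l.drop (sz * j)).take sz).map fun t => ((t.1 : ℝ), t.2)) ζ η
  | 0 => by simp [JPoly.lin]
  | n + 1 => by
    rw [Nat.mul_succ, List.take_add, List.map_append, NullLemmas.lin_append, lin_take_eq_sum l sz ζ η n,
      Finset.sum_range_succ]

end EvaluatorSound

open EvaluatorSound in
/-- **Stub `morawetzPairing_pgv_eq` of crux `OddMorawetzLocal`** (refutation skeleton; evaluator soundness 4/4).
For an explicit polynomial field `P` and an integer jet polynomial `p` on the weight-`k` basis, evaluated by the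
kernel in `n` chunks of `sz` terms with results `(true, r j)`: the field `v = pgv 1 (toP3v P)` is a divergence-free
Schwartz field, and the Morawetz pairing of the coefficient vector `vecOf k p` at `v` is `(Σ_{j<n} r j) · π√π`.
(`morawetzPairing` is `-∫ lin (polyOfV k (vecOf k p)) (Jv)(J B(v,v))`; `lin_polyOfV_vecOf` replaces the polynomial
by `p`, `lin_take_eq_sum` splits it into the chunks, `integral_finsetSum` and `integral_lin_chunk_eq` evaluate.) -/
theorem morawetzPairing_pgv_eq (k : ℕ) (p : JPoly ℤ) (hp : ∀ t ∈ p, t.2 ∈ idx k)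
    (hpw : p.Pairwise fun s t => s.2 ≠ t.2) (P : EField) (fuel sz n : ℕ) (r : ℕ → ℚ) (hn : 0 < n)
    (hcover : p.length ≤ sz * n)
    (hres : ∀ j, j < n → evalRes fuel ((p.drop (sz * j)).take sz) P = (true, r j)) :
    Literature.Analysis.FluidPDE.IsSchwartzField (pgv 1 (toP3v P)) ∧
    Literature.Analysis.FluidPDE.VectorCalculus.IsDivFree (pgv 1 (toP3v P)) ∧
    morawetzPairing k (pgv 1 (toP3v P)) (fun i => ((vecOf k p i : ℤ) : ℝ)) =
      ((∑ j ∈ Finset.range n, r j : ℚ) : ℝ) * (Real.pi * Real.sqrt Real.pi) := by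
  have hdiv := sum_dg_one_eq_zero P (evalRes_spec fuel _ P (r 0) (hres 0 hn)).1
  have hv := isSchwartzField_pgv 1 one_pos (toP3v P)
  have hd := isDivFree_pgv (toP3v P) hdiv
  refine ⟨hv, hd, ?_⟩
  have hper : ∀ j ∈ Finset.range n,
      Integrable (fun x => JPoly.lin (((p.drop (sz * j)).take sz).map fun t => ((t.1 : ℝ), t.2))
          (jetVal (pgv 1 (toP3v P)) x)
          (jetVal (Literature.Analysis.FluidPDE.eulerBilinear (pgv 1 (toP3v P)) (pgv 1 (toP3v P))) x)) ∧
      ∫ x, JPoly.lin (((p.drop (sz * j)).take sz).map fun t => ((t.1 : ℝ), t.2)) (jetVal (pgv 1 (toP3v P)) x)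
          (jetVal (Literature.Analysis.FluidPDE.eulerBilinear (pgv 1 (toP3v P)) (pgv 1 (toP3v P))) x) =
        -(r j : ℝ) * (Real.pi * Real.sqrt Real.pi) := fun j hj =>
    integral_lin_chunk_eq k fuel _ P (r j) (hres j (Finset.mem_range.1 hj)) fun t ht =>
      hp t (List.mem_of_mem_drop (List.mem_of_mem_take ht))
  -- the integrand, chunked
  have hpt : ∀ x, JPoly.lin (polyOfV k fun i => ((vecOf k p i : ℤ) : ℝ)) (jetVal (pgv 1 (toP3v P)) x)
      (jetVal (Literature.Analysis.FluidPDE.eulerBilinear (pgv 1 (toP3v P)) (pgv 1 (toP3v P))) x) =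
      ∑ j ∈ Finset.range n, JPoly.lin (((p.drop (sz * j)).take sz).map fun t => ((t.1 : ℝ), t.2))
        (jetVal (pgv 1 (toP3v P)) x)
        (jetVal (Literature.Analysis.FluidPDE.eulerBilinear (pgv 1 (toP3v P)) (pgv 1 (toP3v P))) x) := by
    intro x
    have h := lin_take_eq_sum p sz (jetVal (pgv 1 (toP3v P)) x)
      (jetVal (Literature.Analysis.FluidPDE.eulerBilinear (pgv 1 (toP3v P)) (pgv 1 (toP3v P))) x) n
    rw [List.take_of_length_le hcover] at h
    rw [(pairing_props k _ hv hd).2.2.2 p hp hpw x]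
    exact h
  unfold morawetzPairing
  simp_rw [hpt]
  rw [integral_finsetSum _ fun j hj => (hper j hj).1, Finset.sum_congr rfl fun j hj => (hper j hj).2]
  push_cast
  rw [Finset.sum_mul, ← Finset.sum_neg_distrib]
  refine Finset.sum_congr rfl fun j _ => ?_
  ring

end Summit.NavierStokesRegularity.NavierStokesRegularity.Theorems.OddMorawetz

end
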